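import Literature.MathematicalPhysics.QuantumLattice.TorusWilsonMarkov
import Summits.QuantumFields.YangMills.Theorems.FradkinShenkerFlowSusceptibilityToPoincareTwoBlockFactorization

/-!
# The cyclic peeling induction (crux `ConvexGribovBody.PoincareToGap`, line `Sketch`, stub P2)

Torus Wilson state `μ = wilsonMeasure r.ρ β` on `GaugeConfig 4 (2S+1) G`; time = coordinate `0`; the ARC
of length `ℓ` from time `s` is the link set `{e | (e.1 0 - s).val < ℓ}`, its complement is
`{e | ℓ ≤ (e.1 0 - s).val}`, `P_D := μ[· | cylinderEvents D]`.

`stub_peelingDecay`: on ONE torus, the two interface hypotheses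
* (hK) kernel versions — for every arc (`1 ≤ ℓ ≤ 2S`) and every bounded measurable gauge-invariant `f`
  reading the arc, `P_{arcᶜ} f` has a measurable, same-bound, gauge-invariant version reading only the
  SPATIAL links at the offsets `ℓ` and `2S` from `s` (the two outer boundary slices), and
* (hR) two-time arc retention with constant `ε ∈ (0, 1]` — for arcs `3 ≤ ℓ ≤ 2S − 2` and bounded
  measurable gauge-invariant `F` reading only the spatial links of the two END slices (offsets `0`,
  `ℓ − 1`): `ε · ∫ (F − ∫ F)² ≤ ∫ (F − P_{arcᶜ} F)²`,
imply the decay `|∫ f g − ∫ f ∫ g| ≤ 2 M_f M_g √(1−ε)^k` for `f` (bounded by `M_f`, gauge invariant)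
reading the arc of width `w` from `a` and `g` (bounded by `M_g`) reading only links at offsets `v` from `a`
with `w + k ≤ v ≤ 2S − k`, whenever `w + 2k + 3 ≤ 2S + 1`.

Proof (peeling).  `F₀ := f − ∫ f` reads the arc `A₀` (length `w` from `a`), `∫ F₀ = 0`,
`∫ F₀ g = ∫ f g − ∫ f ∫ g`, `∫ F₀² ≤ (2M_f)²`.  Step `j` (`0 ≤ j ≤ k`, arc `A_j` of length `w + 2j` from
`a − j`): `F_{j+1}` := the kernel version of `P_{A_jᶜ} F_j` given by (hK); it reads the spatial links at
the offsets `w + 2j`, `2S` from `a − j`, i.e. (a `ZMod.val` identity) the spatial links of the two END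
slices of the arc `A_{j+1}`.  Since `g` is `cylinderEvents A_jᶜ`-measurable (`j ≤ k`), the pull-out
property gives `∫ F_{j+1} g = ∫ F_j g` and `∫ F_{j+1} = ∫ F_j = 0`; Pythagoras gives
`∫ F_{j+1}² = ∫ F_j² − ∫ (F_j − P_{A_jᶜ} F_j)²`, which is `≤ ∫ F_j²` (`j = 0`) and `≤ (1 − ε) ∫ F_j²` for
`j ≥ 1` by (hR) applied to `F_j` on the arc `A_j`.  Hence `∫ F_{k+1}² ≤ (1−ε)^k (2M_f)²` and Cauchy–Schwarz
finishes.  Everything past the probability-measure instance is abstract `L²` calculus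
(`TwoBlock.integral_condExp_mul`, `TwoBlock.integral_sub_condExp_sq`, `TwoBlock.integral_mul_le_sqrt_mul_sqrt`).

References: F. Martinelli, LNM 1717 (1999), §3 (block dynamics, `L²` peeling); H.-O. Georgii, *Gibbs
Measures and Phase Transitions* (2011), §1.2 (local functions are `𝓕_Δ`-measurable).
-/

noncomputable section

open scoped BigOperators Topology
open MeasureTheory ProbabilityTheory Filter
open Literature.MathematicalPhysics.QuantumFieldTheory Literature.MathematicalPhysics.QuantumLattice

namespace Summit.QuantumFields.YangMills.Theorems.PoincareToGap

open Summit.QuantumFields.YangMills.Theorems.SusceptibilityToPoincare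

/-! ### Arithmetic of time offsets on the ring `ℤ/L` -/

/-- On `ℤ/L`, adding `1` to an element of value `t` with `t + 1 < L` gives the value `t + 1`. -/
private theorem val_add_one_of_lt {L : ℕ} [NeZero L] {x : ZMod L} {t : ℕ} (hx : x.val = t)
    (ht : t + 1 < L) : (x + 1).val = t + 1 := by
  rw [ZMod.val_add, hx, ZMod.val_one_eq_one_mod, Nat.mod_eq_of_lt (show 1 < L by omega),
    Nat.mod_eq_of_lt ht]

/-- On `ℤ/(2S+1)`, adding `1` to the element of value `2S` gives the value `0`. -/
private theorem val_add_one_of_eq {S : ℕ} {x : ZMod (2 * S + 1)} (hx : x.val = 2 * S) :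
    (x + 1).val = 0 := by
  haveI : NeZero (2 * S + 1) := ⟨by omega⟩
  have h1 : x + 1 = ((2 * S + 1 : ℕ) : ZMod (2 * S + 1)) := by
    rw [← ZMod.natCast_zmod_val x, hx]; push_cast; ring
  rw [h1, ZMod.natCast_self, ZMod.val_zero]

/-- On `ℤ/L`, `(x + j).val = x.val + j` when no wrap-around occurs. -/
private theorem val_add_natCast_of_lt {L : ℕ} [NeZero L] (x : ZMod L) {j : ℕ} (h : x.val + j < L) :
    (x + (j : ZMod L)).val = x.val + j := by
  rw [ZMod.val_add, ZMod.val_natCast, Nat.mod_eq_of_lt (show j < L by omega), Nat.mod_eq_of_lt h]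

/-! ### `L²` facts for bounded functions on a finite measure space -/

section L2

variable {Ω : Type*} [MeasurableSpace Ω] {μ : Measure Ω}

/-- A measurable real function bounded by `M` is in `L²` of a finite measure. -/
private theorem memLp_two_of_bound [IsFiniteMeasure μ] {f : Ω → ℝ} (hf : Measurable f) {M : ℝ}
    (hb : ∀ x, |f x| ≤ M) : MemLp f 2 μ :=
  MemLp.of_bound hf.aestronglyMeasurable M (ae_of_all _ fun x => by rw [Real.norm_eq_abs]; exact hb x)

/-- On a probability space, `∫ f² ≤ M²` if `|f| ≤ M`. -/
private theorem integral_sq_le_sq [IsProbabilityMeasure μ] {f : Ω → ℝ} {M : ℝ}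
    (hb : ∀ x, |f x| ≤ M) : ∫ x, f x ^ 2 ∂μ ≤ M ^ 2 := by
  have h : ∀ x, f x ^ 2 ≤ M ^ 2 := fun x => by
    rw [← sq_abs (f x)]
    exact pow_le_pow_left₀ (abs_nonneg _) (hb x) 2
  calc ∫ x, f x ^ 2 ∂μ ≤ ∫ _, M ^ 2 ∂μ :=
        integral_mono_of_nonneg (ae_of_all _ fun x => sq_nonneg (f x)) (integrable_const _)
          (ae_of_all _ h)
    _ = M ^ 2 := by rw [integral_const, probReal_univ, one_smul]

/-- Cauchy–Schwarz with an absolute value: `|∫ f g| ≤ √(∫ f²) √(∫ g²)` for `f, g ∈ L²`. -/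
private theorem abs_integral_mul_le {f g : Ω → ℝ} (hf : MemLp f 2 μ) (hg : MemLp g 2 μ) :
    |∫ x, f x * g x ∂μ| ≤ Real.sqrt (∫ x, f x ^ 2 ∂μ) * Real.sqrt (∫ x, g x ^ 2 ∂μ) := by
  refine abs_le.2 ⟨?_, TwoBlock.integral_mul_le_sqrt_mul_sqrt hf hg⟩
  have h := TwoBlock.integral_mul_le_sqrt_mul_sqrt hf.neg hg
  have e1 : ∫ x, (-f) x * g x ∂μ = -∫ x, f x * g x ∂μ := by
    rw [← integral_neg]
    exact integral_congr_ae (ae_of_all _ fun x => by simp only [Pi.neg_apply, neg_mul])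
  have e2 : ∫ x, (-f) x ^ 2 ∂μ = ∫ x, f x ^ 2 ∂μ :=
    integral_congr_ae (ae_of_all _ fun x => by simp only [Pi.neg_apply, neg_sq])
  rw [e1, e2] at h
  linarith

end L2

/-! ### One peeling step -/

/-- **One peeling step.**  Given the kernel-version property (hK) on the torus, an arc of length `ℓ` from
`s` with `ℓ + 2 ≤ 2S + 1`, a bounded measurable gauge-invariant `F` reading the arc and a bounded measurable
`g` reading its complement, the kernel version `F'` of `P_{arcᶜ} F` is measurable, has the same bound, is
gauge invariant, reads only the spatial links of the two end slices of the enlarged arc (length `ℓ + 2` from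
`s' = s − 1`: offsets `0` and `ℓ' = ℓ + 1` from `s'`), and satisfies `∫ F' = ∫ F`, `∫ F' g = ∫ F g`
(pull-out) and `∫ F'² = ∫ F² − ∫ (F − P_{arcᶜ} F)²` (Pythagoras). -/
private theorem peel_step {G : Type} [Group G] [MeasurableSpace G] {S : ℕ}
    {μ : Measure (GaugeConfig 4 (2 * S + 1) G)} [IsProbabilityMeasure μ]
    (hK : ∀ (s : ZMod (2 * S + 1)) (ℓ : ℕ), 1 ≤ ℓ → ℓ + 1 ≤ 2 * S + 1 →
      ∀ (f : GaugeConfig 4 (2 * S + 1) G → ℝ) (M : ℝ), Measurable f → (∀ U, |f U| ≤ M) →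
        IsGaugeInvariant f → DependsOn f {e : Edge 4 (2 * S + 1) | (e.1 0 - s).val < ℓ} →
      ∃ F : GaugeConfig 4 (2 * S + 1) G → ℝ, Measurable F ∧ (∀ U, |F U| ≤ M) ∧ IsGaugeInvariant F ∧
        DependsOn F {e : Edge 4 (2 * S + 1) |
          ((e.1 0 - s).val = ℓ ∨ (e.1 0 - s).val = 2 * S) ∧ e.2 ≠ 0} ∧
        F =ᵐ[μ] condExp (cylinderEvents {e : Edge 4 (2 * S + 1) | ℓ ≤ (e.1 0 - s).val}) μ f)
    (s s' : ZMod (2 * S + 1)) {ℓ ℓ' : ℕ} (hs' : s = s' + 1) (hℓ' : ℓ' = ℓ + 1) (hℓ : 1 ≤ ℓ)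
    (hℓS : ℓ + 2 ≤ 2 * S + 1)
    {F g : GaugeConfig 4 (2 * S + 1) G → ℝ} {M Mg : ℝ} (hFm : Measurable F) (hFb : ∀ U, |F U| ≤ M)
    (hFGI : IsGaugeInvariant F) (hFdep : DependsOn F {e : Edge 4 (2 * S + 1) | (e.1 0 - s).val < ℓ})
    (hgm : Measurable g) (hgb : ∀ U, |g U| ≤ Mg)
    (hgdep : DependsOn g {e : Edge 4 (2 * S + 1) | ℓ ≤ (e.1 0 - s).val}) :
    ∃ F' : GaugeConfig 4 (2 * S + 1) G → ℝ, Measurable F' ∧ (∀ U, |F' U| ≤ M) ∧ IsGaugeInvariant F' ∧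
      DependsOn F' {e : Edge 4 (2 * S + 1) | ((e.1 0 - s').val = 0 ∨ (e.1 0 - s').val = ℓ') ∧ e.2 ≠ 0} ∧
      ∫ U, F' U ∂μ = ∫ U, F U ∂μ ∧ ∫ U, F' U * g U ∂μ = ∫ U, F U * g U ∂μ ∧
      ∫ U, F' U ^ 2 ∂μ = ∫ U, F U ^ 2 ∂μ -
        ∫ U, (F U - condExp (cylinderEvents {e : Edge 4 (2 * S + 1) | ℓ ≤ (e.1 0 - s).val}) μ F U) ^ 2
          ∂μ := by
  haveI : NeZero (2 * S + 1) := ⟨by omega⟩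
  obtain ⟨F', hm', hb', hGI', hdep', hae⟩ := hK s ℓ hℓ (by omega) F M hFm hFb hFGI hFdep
  have hm_le : cylinderEvents (X := fun _ : Edge 4 (2 * S + 1) => G)
      {e : Edge 4 (2 * S + 1) | ℓ ≤ (e.1 0 - s).val} ≤ MeasurableSpace.pi := cylinderEvents_le_pi
  have hF2 : MemLp F 2 μ := memLp_two_of_bound hFm hFb
  have hg2 : MemLp g 2 μ := memLp_two_of_bound hgm hgb
  have hgsm : StronglyMeasurable[cylinderEvents (X := fun _ : Edge 4 (2 * S + 1) => G)
      {e : Edge 4 (2 * S + 1) | ℓ ≤ (e.1 0 - s).val}] g :=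
    (hgm.measurable_cylinderEvents_of_dependsOn hgdep).stronglyMeasurable
  refine ⟨F', hm', hb', hGI', hdep'.mono ?_, ?_, ?_, ?_⟩
  · -- the outer boundary slices of the arc are the end slices of the enlarged arc
    intro e he
    simp only [Set.mem_setOf_eq] at he ⊢
    refine ⟨?_, he.2⟩
    have e1 : e.1 0 - s' = (e.1 0 - s) + 1 := by rw [hs']; ring
    rw [e1]
    rcases he.1 with h | h
    · right
      rw [hℓ']
      exact val_add_one_of_lt h (by omega)
    · exact Or.inl (val_add_one_of_eq h)
  · -- mean
    rw [integral_congr_ae hae]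
    exact integral_condExp hm_le
  · -- pull-out
    have hae' : (fun U => F' U * g U) =ᵐ[μ] fun U =>
        condExp (cylinderEvents {e : Edge 4 (2 * S + 1) | ℓ ≤ (e.1 0 - s).val}) μ F U * g U := by
      filter_upwards [hae] with U hU
      rw [hU]
    rw [integral_congr_ae hae']
    exact TwoBlock.integral_condExp_mul hm_le hF2 hg2 hgsm
  · -- Pythagoras
    rw [integral_sq_congr_ae hae, TwoBlock.integral_sub_condExp_sq hm_le hF2]
    ring

/-! ### The peeling induction -/

/-- **The peeling induction.**  With (hK) and the retention hypothesis (hR) on the torus, a centred bounded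
measurable gauge-invariant `F₀` reading the arc of width `w` from `a`, and `g` reading only the offsets
`w + k ≤ · ≤ 2S − k` from `a` (`w ≥ 1`, `w + 2k + 3 ≤ 2S + 1`): for every `n ≤ k` there is `F = F_{n+1}`,
measurable, with the bound of `F₀`, gauge invariant, reading only the spatial links of the two end slices
of the arc of length `w + 2(n+1)` from `a − (n+1)`, centred, with `∫ F g = ∫ F₀ g` and
`∫ F² ≤ (1 − ε)^n ∫ F₀²`. -/
private theorem peel_iter {G : Type} [Group G] [MeasurableSpace G] {S : ℕ}
    {μ : Measure (GaugeConfig 4 (2 * S + 1) G)} [IsProbabilityMeasure μ] {ε : ℝ} (hε1 : ε ≤ 1)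
    (hK : ∀ (s : ZMod (2 * S + 1)) (ℓ : ℕ), 1 ≤ ℓ → ℓ + 1 ≤ 2 * S + 1 →
      ∀ (f : GaugeConfig 4 (2 * S + 1) G → ℝ) (M : ℝ), Measurable f → (∀ U, |f U| ≤ M) →
        IsGaugeInvariant f → DependsOn f {e : Edge 4 (2 * S + 1) | (e.1 0 - s).val < ℓ} →
      ∃ F : GaugeConfig 4 (2 * S + 1) G → ℝ, Measurable F ∧ (∀ U, |F U| ≤ M) ∧ IsGaugeInvariant F ∧
        DependsOn F {e : Edge 4 (2 * S + 1) |
          ((e.1 0 - s).val = ℓ ∨ (e.1 0 - s).val = 2 * S) ∧ e.2 ≠ 0} ∧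
        F =ᵐ[μ] condExp (cylinderEvents {e : Edge 4 (2 * S + 1) | ℓ ≤ (e.1 0 - s).val}) μ f)
    (hR : ∀ (s : ZMod (2 * S + 1)) (ℓ : ℕ), 3 ≤ ℓ → ℓ + 3 ≤ 2 * S + 1 →
      ∀ F : GaugeConfig 4 (2 * S + 1) G → ℝ, Measurable F → (∃ M : ℝ, ∀ U, |F U| ≤ M) →
        IsGaugeInvariant F →
        DependsOn F {e : Edge 4 (2 * S + 1) |
          ((e.1 0 - s).val = 0 ∨ (e.1 0 - s).val = ℓ - 1) ∧ e.2 ≠ 0} →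
      ε * ∫ U, (F U - ∫ V, F V ∂μ) ^ 2 ∂μ ≤
        ∫ U, (F U - condExp (cylinderEvents {e : Edge 4 (2 * S + 1) | ℓ ≤ (e.1 0 - s).val}) μ F U) ^ 2 ∂μ)
    (a : ZMod (2 * S + 1)) {w k : ℕ} (hw : 1 ≤ w) (hwk : w + 2 * k + 3 ≤ 2 * S + 1)
    {g : GaugeConfig 4 (2 * S + 1) G → ℝ} {Mg : ℝ} (hgm : Measurable g) (hgb : ∀ U, |g U| ≤ Mg)
    (hgdep : DependsOn g
      {e : Edge 4 (2 * S + 1) | w + k ≤ (e.1 0 - a).val ∧ (e.1 0 - a).val + k ≤ 2 * S})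
    {F₀ : GaugeConfig 4 (2 * S + 1) G → ℝ} {M : ℝ} (h0m : Measurable F₀) (h0b : ∀ U, |F₀ U| ≤ M)
    (h0GI : IsGaugeInvariant F₀) (h0dep : DependsOn F₀ {e : Edge 4 (2 * S + 1) | (e.1 0 - a).val < w})
    (h0int : ∫ U, F₀ U ∂μ = 0) (n : ℕ) (hn : n ≤ k) :
    ∃ F : GaugeConfig 4 (2 * S + 1) G → ℝ, Measurable F ∧ (∀ U, |F U| ≤ M) ∧ IsGaugeInvariant F ∧
      DependsOn F {e : Edge 4 (2 * S + 1) |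
        ((e.1 0 - (a - ((n + 1 : ℕ) : ZMod (2 * S + 1)))).val = 0 ∨
          (e.1 0 - (a - ((n + 1 : ℕ) : ZMod (2 * S + 1)))).val = w + 2 * (n + 1) - 1) ∧ e.2 ≠ 0} ∧
      ∫ U, F U ∂μ = 0 ∧ ∫ U, F U * g U ∂μ = ∫ U, F₀ U * g U ∂μ ∧
      ∫ U, F U ^ 2 ∂μ ≤ (1 - ε) ^ n * ∫ U, F₀ U ^ 2 ∂μ := by
  haveI : NeZero (2 * S + 1) := ⟨by omega⟩
  induction n with
  | zero =>
    -- step `j = 0`: the arc of length `w` from `a`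
    have hsub : {e : Edge 4 (2 * S + 1) | w + k ≤ (e.1 0 - a).val ∧ (e.1 0 - a).val + k ≤ 2 * S} ⊆
        {e : Edge 4 (2 * S + 1) | w ≤ (e.1 0 - a).val} := fun e he => by
      simp only [Set.mem_setOf_eq] at he ⊢
      omega
    obtain ⟨F', h1, h2, h3, h4, h5, h6, h7⟩ := peel_step hK a (a - ((0 + 1 : ℕ) : ZMod (2 * S + 1)))
      (ℓ := w) (ℓ' := w + 2 * (0 + 1) - 1) (by push_cast; ring) (by omega) hw (by omega)
      h0m h0b h0GI h0dep hgm hgb (hgdep.mono hsub)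
    refine ⟨F', h1, h2, h3, h4, h5.trans h0int, h6, ?_⟩
    have hnn : 0 ≤ ∫ U, (F₀ U -
        condExp (cylinderEvents {e : Edge 4 (2 * S + 1) | w ≤ (e.1 0 - a).val}) μ F₀ U) ^ 2 ∂μ :=
      integral_nonneg fun U => sq_nonneg _
    rw [h7, pow_zero, one_mul]
    linarith
  | succ n ih =>
    obtain ⟨F, hFm, hFb, hFGI, hFdep, hF0, hFg, hFsq⟩ := ih (by omega)
    -- step `j = n + 1`: the arc of length `w + 2(n+1)` from `a - (n+1)`; `F` reads it
    have hFarc : DependsOn F {e : Edge 4 (2 * S + 1) |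
        (e.1 0 - (a - ((n + 1 : ℕ) : ZMod (2 * S + 1)))).val < w + 2 * (n + 1)} :=
      hFdep.mono fun e he => by
        simp only [Set.mem_setOf_eq] at he ⊢
        omega
    -- `g` reads its complement (no wrap-around: `(e.1 0 - a).val + (n + 1) ≤ 2S`)
    have hgc : DependsOn g {e : Edge 4 (2 * S + 1) |
        w + 2 * (n + 1) ≤ (e.1 0 - (a - ((n + 1 : ℕ) : ZMod (2 * S + 1)))).val} := by
      refine hgdep.mono fun e he => ?_
      simp only [Set.mem_setOf_eq] at he ⊢
      have e1 : e.1 0 - (a - ((n + 1 : ℕ) : ZMod (2 * S + 1))) =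
          (e.1 0 - a) + ((n + 1 : ℕ) : ZMod (2 * S + 1)) := by ring
      rw [e1, val_add_natCast_of_lt _ (by omega)]
      omega
    obtain ⟨F', h1, h2, h3, h4, h5, h6, h7⟩ := peel_step hK (a - ((n + 1 : ℕ) : ZMod (2 * S + 1)))
      (a - ((n + 1 + 1 : ℕ) : ZMod (2 * S + 1))) (ℓ := w + 2 * (n + 1)) (ℓ' := w + 2 * (n + 1 + 1) - 1)
      (by push_cast; ring) (by omega) (by omega) (by omega) hFm hFb hFGI hFarc hgm hgb hgc
    -- retention on the arc `A_{n+1}` for the centred `F`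
    have hret := hR (a - ((n + 1 : ℕ) : ZMod (2 * S + 1))) (w + 2 * (n + 1)) (by omega) (by omega) F hFm
      ⟨M, hFb⟩ hFGI hFdep
    rw [hF0] at hret
    simp only [sub_zero] at hret
    refine ⟨F', h1, h2, h3, h4, h5.trans hF0, h6.trans hFg, ?_⟩
    have h1ε : 0 ≤ 1 - ε := sub_nonneg.2 hε1
    rw [h7, pow_succ]
    calc ∫ U, F U ^ 2 ∂μ - ∫ U, (F U - condExp (cylinderEvents {e : Edge 4 (2 * S + 1) |
            w + 2 * (n + 1) ≤ (e.1 0 - (a - ((n + 1 : ℕ) : ZMod (2 * S + 1)))).val}) μ F U) ^ 2 ∂μ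
          ≤ (1 - ε) * ∫ U, F U ^ 2 ∂μ := by linarith
      _ ≤ (1 - ε) * ((1 - ε) ^ n * ∫ U, F₀ U ^ 2 ∂μ) := mul_le_mul_of_nonneg_left hFsq h1ε
      _ = (1 - ε) ^ n * (1 - ε) * ∫ U, F₀ U ^ 2 ∂μ := by ring

/-! ### The stub -/

/-- `stub_peelingDecay` — **the cyclic peeling induction on one torus** (P2 of the line `Sketch`).
Hypotheses (interfaces, for the fixed torus `S` and `μ = wilsonMeasure r.ρ β`): the kernel-version property
(hK) and two-time arc retention (hR) with constant `ε ∈ (0, 1]`.  Conclusion: for `f` bounded measurable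
gauge-invariant reading only the arc of width `w ≥ 1` from time `a`, and `g` bounded measurable reading only
links at offsets `w + k ≤ · ≤ 2S − k` from `a` (distance `≥ k` from the arc on both sides of the cycle), with
room `w + 2k + 3 ≤ 2S + 1`:  `|∫ f g − ∫ f ∫ g| ≤ 2 M_f M_g (√(1−ε))^k`.
Proof: `F₀ := f − ∫ f`; `k + 1` peeling steps (`peel_iter`: kernel version, pull-out, Pythagoras, retention)
give `F` with `∫ F g = ∫ f g − ∫ f ∫ g` and `∫ F² ≤ (1−ε)^k (2M_f)²`; Cauchy–Schwarz. -/
theorem stub_peelingDecay :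
    ∀ (G : Type) [Group G] [TopologicalSpace G] [IsTopologicalGroup G] [CompactSpace G]
      [MeasurableSpace G] [BorelSpace G] (r : LatticeRep G) (β : ℝ) (S : ℕ)
      (μ : Measure (GaugeConfig 4 (2 * S + 1) G)),
      μ = (wilsonMeasure r.ρ β : Measure (GaugeConfig 4 (2 * S + 1) G)) →
    ∀ ε : ℝ, 0 < ε → ε ≤ 1 →
    (∀ (s : ZMod (2 * S + 1)) (ℓ : ℕ), 1 ≤ ℓ → ℓ + 1 ≤ 2 * S + 1 →
      ∀ (f : GaugeConfig 4 (2 * S + 1) G → ℝ) (M : ℝ), Measurable f → (∀ U, |f U| ≤ M) →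
        IsGaugeInvariant f → DependsOn f {e : Edge 4 (2 * S + 1) | (e.1 0 - s).val < ℓ} →
      ∃ F : GaugeConfig 4 (2 * S + 1) G → ℝ, Measurable F ∧ (∀ U, |F U| ≤ M) ∧ IsGaugeInvariant F ∧
        DependsOn F {e : Edge 4 (2 * S + 1) |
          ((e.1 0 - s).val = ℓ ∨ (e.1 0 - s).val = 2 * S) ∧ e.2 ≠ 0} ∧
        F =ᵐ[μ] condExp (cylinderEvents {e : Edge 4 (2 * S + 1) | ℓ ≤ (e.1 0 - s).val}) μ f) →
    (∀ (s : ZMod (2 * S + 1)) (ℓ : ℕ), 3 ≤ ℓ → ℓ + 3 ≤ 2 * S + 1 →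
      ∀ F : GaugeConfig 4 (2 * S + 1) G → ℝ, Measurable F → (∃ M : ℝ, ∀ U, |F U| ≤ M) →
        IsGaugeInvariant F →
        DependsOn F {e : Edge 4 (2 * S + 1) |
          ((e.1 0 - s).val = 0 ∨ (e.1 0 - s).val = ℓ - 1) ∧ e.2 ≠ 0} →
      ε * ∫ U, (F U - ∫ V, F V ∂μ) ^ 2 ∂μ ≤
        ∫ U, (F U - condExp (cylinderEvents {e : Edge 4 (2 * S + 1) | ℓ ≤ (e.1 0 - s).val}) μ F U) ^ 2 ∂μ) →
    ∀ (a : ZMod (2 * S + 1)) (w k : ℕ), 1 ≤ w → w + 2 * k + 3 ≤ 2 * S + 1 →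
    ∀ (f g : GaugeConfig 4 (2 * S + 1) G → ℝ) (Mf Mg : ℝ),
      Measurable f → (∀ U, |f U| ≤ Mf) → IsGaugeInvariant f →
      DependsOn f {e : Edge 4 (2 * S + 1) | (e.1 0 - a).val < w} →
      Measurable g → (∀ U, |g U| ≤ Mg) →
      DependsOn g {e : Edge 4 (2 * S + 1) | w + k ≤ (e.1 0 - a).val ∧ (e.1 0 - a).val + k ≤ 2 * S} →
    |∫ U, f U * g U ∂μ - (∫ U, f U ∂μ) * ∫ U, g U ∂μ| ≤ 2 * Mf * Mg * Real.sqrt (1 - ε) ^ k := by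
  intro G _ _ _ _ _ _ r β S μ hμ ε _hε0 hε1 hK hR a w k hw hwk f g Mf Mg hfm hfb hfGI hfdep hgm hgb hgdep
  haveI : IsProbabilityMeasure μ := by
    rw [hμ]
    exact isProbabilityMeasure_wilsonMeasure (d := 4) (L := 2 * S + 1) r.ρ r.continuous β
  -- the bounds are nonnegative (evaluate at the trivial configuration)
  have hMf : 0 ≤ Mf := (abs_nonneg _).trans (hfb fun _ => 1)
  have hMg : 0 ≤ Mg := (abs_nonneg _).trans (hgb fun _ => 1)
  have hf2 : MemLp f 2 μ := memLp_two_of_bound hfm hfb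
  have hg2 : MemLp g 2 μ := memLp_two_of_bound hgm hgb
  have hfi : Integrable f μ := hf2.integrable one_le_two
  have hgi : Integrable g μ := hg2.integrable one_le_two
  have hcf : |∫ U, f U ∂μ| ≤ Mf := by
    have h := norm_integral_le_of_norm_le_const (μ := μ) (f := f) (C := Mf)
      (ae_of_all _ fun U => by rw [Real.norm_eq_abs]; exact hfb U)
    rwa [Real.norm_eq_abs, probReal_univ, mul_one] at h
  -- the centred observable `F₀ = f - ∫ f`
  obtain ⟨F₀, hF₀⟩ : ∃ F₀ : GaugeConfig 4 (2 * S + 1) G → ℝ, ∀ U, F₀ U = f U - ∫ V, f V ∂μ :=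
    ⟨_, fun U => rfl⟩
  have hF₀' : F₀ = fun U => f U - ∫ V, f V ∂μ := funext hF₀
  have h0m : Measurable F₀ := by rw [hF₀']; exact hfm.sub measurable_const
  have h0b : ∀ U, |F₀ U| ≤ 2 * Mf := fun U => by
    rw [hF₀]
    calc |f U - ∫ V, f V ∂μ| ≤ |f U| + |∫ V, f V ∂μ| := abs_sub _ _
      _ ≤ Mf + Mf := add_le_add (hfb U) hcf
      _ = 2 * Mf := by ring
  have h0GI : IsGaugeInvariant F₀ := fun q U => by rw [hF₀, hF₀, hfGI q U]
  have h0dep : DependsOn F₀ {e : Edge 4 (2 * S + 1) | (e.1 0 - a).val < w} := fun U V hUV => by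
    rw [hF₀, hF₀, hfdep hUV]
  have h0int : ∫ U, F₀ U ∂μ = 0 := by
    rw [hF₀', integral_sub hfi (integrable_const _), integral_const, probReal_univ, one_smul, sub_self]
  have h0g : ∫ U, F₀ U * g U ∂μ = ∫ U, f U * g U ∂μ - (∫ U, f U ∂μ) * ∫ U, g U ∂μ := by
    have e : ∀ U, F₀ U * g U = f U * g U - (∫ V, f V ∂μ) * g U := fun U => by rw [hF₀]; ring
    simp_rw [e]
    rw [integral_sub (TwoBlock.integrable_mul_of_memLp hf2 hg2) (hgi.const_mul _), integral_const_mul]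
  have h0sq : ∫ U, F₀ U ^ 2 ∂μ ≤ (2 * Mf) ^ 2 := integral_sq_le_sq h0b
  -- `k + 1` peeling steps
  obtain ⟨F, hFm, hFb, -, -, -, hFg, hFsq⟩ :=
    peel_iter hε1 hK hR a hw hwk hgm hgb hgdep h0m h0b h0GI h0dep h0int k le_rfl
  -- Cauchy–Schwarz
  have hF2 : MemLp F 2 μ := memLp_two_of_bound hFm hFb
  have h1ε : 0 ≤ 1 - ε := sub_nonneg.2 hε1
  have hT : 0 ≤ 2 * Mf * Real.sqrt (1 - ε) ^ k :=
    mul_nonneg (mul_nonneg zero_le_two hMf) (pow_nonneg (Real.sqrt_nonneg _) k)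
  have hs2 : (Real.sqrt (1 - ε) ^ k) ^ 2 = (1 - ε) ^ k := by
    rw [← pow_mul, mul_comm, pow_mul, Real.sq_sqrt h1ε]
  have hsqF : Real.sqrt (∫ U, F U ^ 2 ∂μ) ≤ 2 * Mf * Real.sqrt (1 - ε) ^ k := by
    rw [Real.sqrt_le_left hT]
    calc ∫ U, F U ^ 2 ∂μ ≤ (1 - ε) ^ k * ∫ U, F₀ U ^ 2 ∂μ := hFsq
      _ ≤ (1 - ε) ^ k * (2 * Mf) ^ 2 := mul_le_mul_of_nonneg_left h0sq (pow_nonneg h1ε k)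
      _ = (2 * Mf * Real.sqrt (1 - ε) ^ k) ^ 2 := by rw [mul_pow (2 * Mf), hs2]; ring
  have hsqg : Real.sqrt (∫ U, g U ^ 2 ∂μ) ≤ Mg := by
    rw [Real.sqrt_le_left hMg]
    exact integral_sq_le_sq hgb
  rw [← h0g, ← hFg]
  calc |∫ U, F U * g U ∂μ| ≤ Real.sqrt (∫ U, F U ^ 2 ∂μ) * Real.sqrt (∫ U, g U ^ 2 ∂μ) :=
        abs_integral_mul_le hF2 hg2
    _ ≤ (2 * Mf * Real.sqrt (1 - ε) ^ k) * Mg := mul_le_mul hsqF hsqg (Real.sqrt_nonneg _) hT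
    _ = 2 * Mf * Mg * Real.sqrt (1 - ε) ^ k := by ring

end Summit.QuantumFields.YangMills.Theorems.PoincareToGap

end
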